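import Summits.QuantumFields.BalabanUV.Beta.GAN24.CombExchangeESectorLatticeWords
import Summits.QuantumFields.BalabanUV.Beta.GAN24.CombesThomas

/-!
# `BalabanUV.Beta.GAN24.CombExchangeESectorPairFormAn1` — binder row G-an2-4 ∕ (CONV-C), W-slot CT-W, the COMB chart (III′), J2_comb step T5: **J2_comb(j+1) IN THE OWNER's LETTERS** — the
# hypothesis `hR` of OWNER gan24-p1 g53's `CombForcingPairFormSucc.pairFormLS_combForcing_succ_of_pairForm` (generic `d`, at the Ward pins; §1) and of
# `pairFormLS_combForcing_succ_an1_of_pairForm` ∕ W `CombChargeLevelSuccRowsOfCellTotals` (`d = 3`, units `sfStep Lc (j+1)` ∕ `smStep 3 Lc (j+1)`, record `symTablesAn1S2 3 Lc cΛ`, pins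
# `cE = Lc⁴`, `cVH = −Lc⁸∕2`, scale `Lc⁸·Lc^{2(3+1)}`; §2) VERBATIM (journal [GAN24P1-G53-INTENT-2] l.67678, [INTENT-3] l.67683) — both ONE instantiation of my T4
# `CombExchangeESectorLatticeWords.exists_pairForm_eeWords_smul`

NOT IN PRINT; OUR BOOKKEEPING ([folklore] respelling BY NAME: `Lc^(3+1) = Lc⁴`, `−(Lc^(3+1)·½·Lc^(3+1)) = −Lc⁸∕2` (`ring`); G-an2-4 formalisation swarm, leaf prover
`b2b-balaban-gan24-formalise-leaf-01`, gen 87, file T5; 0 `def`, 0 cited facts, 0 `def … : Prop`, 0 sorry).  HONEST FRAMING (cell contract, verbatim): «discharging `BetaPertH` makes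
Bałaban's UV stability UNCONDITIONAL — a real constructive-QFT result; it is NOT the continuum limit and NOT the Clay problem.»  HONEST DEPENDENCY (verbatim): «continuum YM on T⁴ ⇐ BetaPertH ∧
nine spine estimates (0/9 proved); BetaPertH ⇐ (D1) ∧ (D4) ∧ CAP+tail; G-an2-4 gates asym, D1 and NE2/3/4.»

WHAT ([folklore]; `[NeZero Lc]`, NO parity ∕ size hypothesis on `Lc`): §1 **`exists_pairForm_comb_eeWords_pins`** (generic `d`, every `j cΛt cΛ c`, all units); §2 **`exists_pairForm_comb_eeWords_an1`** —
the OWNER's `hR` ∕ W's `hRs i` at `d = 3` BYTE-VERBATIM.  Together with S `CombExitFaceCurrentCellTotalsAn1.comb_sum_box_current_E_eq_zero_an1` (`hZ`), the OWNER's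
`pairFormLS_combForcing_succ_an1_of_pairForm cΛ cB j hZ hR` — `hB0 (j+1)` of the (III′) (C)-row — has BOTH suppliers (`Odd Lc`, `3 ≤ Lc`).  Asserts NO value of Bałaban's tables beyond
an2's ∕ an1's DEFINED ones; hXF(l+1), (b), W-an2-1′ untouched; NEVER «G-an2-4 closed» as (CONV-C); NOT D1, NOT `BetaPertH`, NOT continuum, NOT Clay.  2026-08-27; no existing file touched.
-/

noncomputable section

open Finset
open scoped BigOperators
open Literature.MathematicalPhysics.QuantumFieldTheory
open Literature.MathematicalPhysics.QuantumFieldTheory.Balaban1983to89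
open Literature.MathematicalPhysics.QuantumFieldTheory.Balaban1983to89.Beta
open ExpKernelCalculus (Site MKer comp)
open AffineAveraging (box toSite)
open AveragingContoursRooted (ctr ctrOff)
open OneStepResolventKernel (Fib)
open OneStepKernelFamily (KInvStep vertexOfK)
open BalabanStepJetsSucc (wE)
open Summit.QuantumFields.BalabanUV.Beta.TameKernelCalculus (trK)
open Summit.QuantumFields.BalabanUV.Beta.AxialDressingRooted (coDressKBmAt)
open Summit.QuantumFields.BalabanUV.Beta.HessKerDressedUnits (unitK unitS)
open Summit.QuantumFields.BalabanUV.Beta.SpineRooted (e3OfK)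
open Summit.QuantumFields.BalabanUV.Beta.SymSecondOrderTablesAn1 (symTablesAn1S2)
open Summit.QuantumFields.BalabanUV.Beta.CombChartStepJets (ScombOf)
open Summit.QuantumFields.BalabanUV.Beta.SymCorrectorKernel (psiKS)
open Summit.QuantumFields.BalabanUV.Beta.SymCorrectorFace (slotPsiS)
open Summit.QuantumFields.BalabanUV.Beta.GAN24.CombesThomas (sfStep smStep)
open Summit.QuantumFields.BalabanUV.Beta.GAN24.CombExchangeESectorLatticeWords (exists_pairForm_eeWords_smul)

namespace Summit.QuantumFields.BalabanUV.Beta.GAN24.CombExchangeESectorPairFormAn1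

variable {Lc : ℕ} [NeZero Lc]

/-! ## §1 Generic `d`, the Ward pins -/

/-- [folklore] **J2_comb(j+1) IN THE OWNER's GENERIC LETTERS AT THE WARD PINS**: the `hR` of `CombForcingPairFormSucc.pairFormLS_combForcing_succ_of_pairForm` at `cE := Lc^(d+1)`,
`cVH := −(Lc^(d+1)·½·Lc^(d+1))` (every `d j cΛt cΛ c`, all units `s_f s_m`). -/
theorem exists_pairForm_comb_eeWords_pins {d : ℕ} (cΛt sf sm cΛ c : ℝ) (j : ℕ) :
    ∃ R : Fin (d + 1) → Fin (d + 1) → Fin (d + 1) → Fin (d + 1) → ℝ,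
      (∀ a b c e : Fin (d + 1), R b a c e = -R a b c e) ∧ (∀ a b c e : Fin (d + 1), R a b e c = -R a b c e) ∧
      ∀ κ κ' κ₁ κ₂ : Fin (d + 1),
        c * (-((sf * sm * ((((Lc ^ (j + 1 + 1) : ℕ) : ℝ)) ^ (d + 1 + 1))⁻¹) * (sf * sm * ((((Lc ^ (j + 1 + 1) : ℕ) : ℝ)) ^ (d + 1 + 1))⁻¹)) * ((Lc : ℝ) * (Lc : ℝ))) *
          ((∑ c ∈ box (d + 1) Lc, ∑' u' : Site (d + 1), ∑' yw : Site (d + 1) × Site (d + 1), (if yw.1 κ₁ % (Lc : ℤ) = (Lc : ℤ) - 1 then (1 : ℝ) else 0) * (if yw.2 κ₂ % (Lc : ℤ) = (Lc : ℤ) - 1 then (1 : ℝ) else 0) *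
        comp (comp (vertexOfK (unitK sf sm (coDressKBmAt (toSite (ctrOff (d + 1) Lc)) Lc (KInvStep (d := d) Lc (j + 1)))) Lc (unitS sf sm (fun κ t => (((Lc : ℝ) ^ (d + 1)) * wE d Lc (j + 1)) • e3OfK Lc (coDressKBmAt (toSite (ctrOff (d + 1) Lc)) Lc (KInvStep (d := d) Lc j))
              (fun κ u => comp (comp (trK (psiKS (ctrOff (d + 1) Lc) Lc)) (slotPsiS (ctrOff (d + 1) Lc) Lc (ScombOf (symTablesAn1S2 d Lc cΛt) ((Lc : ℝ) ^ (d + 1)) (-((Lc : ℝ) ^ (d + 1) * (1 / 2) * (Lc : ℝ) ^ (d + 1))) cΛ j) κ u)) (psiKS (ctrOff (d + 1) Lc) Lc)) κ t)) κ (toSite c)) (unitK sf sm (coDressKBmAt (toSite (ctrOff (d + 1) Lc)) Lc (KInvStep (d := d) Lc (j + 1)))))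
          (vertexOfK (unitK sf sm (coDressKBmAt (toSite (ctrOff (d + 1) Lc)) Lc (KInvStep (d := d) Lc (j + 1)))) Lc (unitS sf sm (fun κ t => (((Lc : ℝ) ^ (d + 1)) * wE d Lc (j + 1)) • e3OfK Lc (coDressKBmAt (toSite (ctrOff (d + 1) Lc)) Lc (KInvStep (d := d) Lc j))
              (fun κ u => comp (comp (trK (psiKS (ctrOff (d + 1) Lc) Lc)) (slotPsiS (ctrOff (d + 1) Lc) Lc (ScombOf (symTablesAn1S2 d Lc cΛt) ((Lc : ℝ) ^ (d + 1)) (-((Lc : ℝ) ^ (d + 1) * (1 / 2) * (Lc : ℝ) ^ (d + 1))) cΛ j) κ u)) (psiKS (ctrOff (d + 1) Lc) Lc)) κ t)) κ' u') yw.1 yw.2 (Sum.inl κ₁) (Sum.inl κ₂)) +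
            (∑ c ∈ box (d + 1) Lc, ∑' u' : Site (d + 1), ∑' yw : Site (d + 1) × Site (d + 1), (if yw.1 κ₁ % (Lc : ℤ) = (Lc : ℤ) - 1 then (1 : ℝ) else 0) * (if yw.2 κ₂ % (Lc : ℤ) = (Lc : ℤ) - 1 then (1 : ℝ) else 0) *
        comp (comp (vertexOfK (unitK sf sm (coDressKBmAt (toSite (ctrOff (d + 1) Lc)) Lc (KInvStep (d := d) Lc (j + 1)))) Lc (unitS sf sm (fun κ t => (((Lc : ℝ) ^ (d + 1)) * wE d Lc (j + 1)) • e3OfK Lc (coDressKBmAt (toSite (ctrOff (d + 1) Lc)) Lc (KInvStep (d := d) Lc j))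
              (fun κ u => comp (comp (trK (psiKS (ctrOff (d + 1) Lc) Lc)) (slotPsiS (ctrOff (d + 1) Lc) Lc (ScombOf (symTablesAn1S2 d Lc cΛt) ((Lc : ℝ) ^ (d + 1)) (-((Lc : ℝ) ^ (d + 1) * (1 / 2) * (Lc : ℝ) ^ (d + 1))) cΛ j) κ u)) (psiKS (ctrOff (d + 1) Lc) Lc)) κ t)) κ' u') (unitK sf sm (coDressKBmAt (toSite (ctrOff (d + 1) Lc)) Lc (KInvStep (d := d) Lc (j + 1)))))
          (vertexOfK (unitK sf sm (coDressKBmAt (toSite (ctrOff (d + 1) Lc)) Lc (KInvStep (d := d) Lc (j + 1)))) Lc (unitS sf sm (fun κ t => (((Lc : ℝ) ^ (d + 1)) * wE d Lc (j + 1)) • e3OfK Lc (coDressKBmAt (toSite (ctrOff (d + 1) Lc)) Lc (KInvStep (d := d) Lc j))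
              (fun κ u => comp (comp (trK (psiKS (ctrOff (d + 1) Lc) Lc)) (slotPsiS (ctrOff (d + 1) Lc) Lc (ScombOf (symTablesAn1S2 d Lc cΛt) ((Lc : ℝ) ^ (d + 1)) (-((Lc : ℝ) ^ (d + 1) * (1 / 2) * (Lc : ℝ) ^ (d + 1))) cΛ j) κ u)) (psiKS (ctrOff (d + 1) Lc) Lc)) κ t)) κ (toSite c)) yw.1 yw.2 (Sum.inl κ₁) (Sum.inl κ₂)))
        = R κ κ₁ κ' κ₂ + R κ' κ₁ κ κ₂ :=
  exists_pairForm_eeWords_smul (d := d) (Lc := Lc) cΛt sf sm (((Lc : ℝ) ^ (d + 1)) * wE d Lc (j + 1)) cΛ j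
    (c * (-((sf * sm * ((((Lc ^ (j + 1 + 1) : ℕ) : ℝ)) ^ (d + 1 + 1))⁻¹) * (sf * sm * ((((Lc ^ (j + 1 + 1) : ℕ) : ℝ)) ^ (d + 1 + 1))⁻¹)) * ((Lc : ℝ) * (Lc : ℝ))))

/-! ## §2 an1's `d = 3` literal -/

/-- [folklore] **J2_comb(j+1) — THE OWNER's `hR` VERBATIM** (`d = 3`, units `sfStep Lc (j+1)` ∕ `smStep 3 Lc (j+1)`, record `symTablesAn1S2 3 Lc cΛ`, pins `cE = Lc⁴`, `cVH = −Lc⁸∕2`, scale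
`Lc⁸·Lc^(2(3+1))`; every `j cΛ`): the hypothesis `hR` of `CombForcingPairFormSucc.pairFormLS_combForcing_succ_an1_of_pairForm` ∕ `hRs j` of W DISCHARGED. -/
theorem exists_pairForm_comb_eeWords_an1 (cΛ : ℝ) (j : ℕ) :
    ∃ R : Fin (3 + 1) → Fin (3 + 1) → Fin (3 + 1) → Fin (3 + 1) → ℝ,
      (∀ a b c e : Fin (3 + 1), R b a c e = -R a b c e) ∧ (∀ a b c e : Fin (3 + 1), R a b e c = -R a b c e) ∧
      ∀ κ κ' κ₁ κ₂ : Fin (3 + 1),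
        ((Lc : ℝ) ^ 8 * (Lc : ℝ) ^ (2 * (3 + 1))) * (-((sfStep Lc (j + 1) * smStep 3 Lc (j + 1) * ((((Lc ^ (j + 1 + 1) : ℕ) : ℝ)) ^ (3 + 1 + 1))⁻¹) * (sfStep Lc (j + 1) * smStep 3 Lc (j + 1) * ((((Lc ^ (j + 1 + 1) : ℕ) : ℝ)) ^ (3 + 1 + 1))⁻¹)) * ((Lc : ℝ) * (Lc : ℝ))) *
          ((∑ c ∈ box (3 + 1) Lc, ∑' u' : Site (3 + 1), ∑' yw : Site (3 + 1) × Site (3 + 1), (if yw.1 κ₁ % (Lc : ℤ) = (Lc : ℤ) - 1 then (1 : ℝ) else 0) * (if yw.2 κ₂ % (Lc : ℤ) = (Lc : ℤ) - 1 then (1 : ℝ) else 0) *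
        comp (comp (vertexOfK (unitK (sfStep Lc (j + 1)) (smStep 3 Lc (j + 1)) (coDressKBmAt (toSite (ctrOff (3 + 1) Lc)) Lc (KInvStep (d := 3) Lc (j + 1)))) Lc (unitS (sfStep Lc (j + 1)) (smStep 3 Lc (j + 1)) (fun κ t => ((Lc : ℝ) ^ 4 * wE 3 Lc (j + 1)) • e3OfK Lc (coDressKBmAt (toSite (ctrOff (3 + 1) Lc)) Lc (KInvStep (d := 3) Lc j))
              (fun κ u => comp (comp (trK (psiKS (ctrOff (3 + 1) Lc) Lc)) (slotPsiS (ctrOff (3 + 1) Lc) Lc (ScombOf (symTablesAn1S2 3 Lc cΛ) ((Lc : ℝ) ^ 4) (-((Lc : ℝ) ^ 8 / 2)) cΛ j) κ u)) (psiKS (ctrOff (3 + 1) Lc) Lc)) κ t)) κ (toSite c)) (unitK (sfStep Lc (j + 1)) (smStep 3 Lc (j + 1)) (coDressKBmAt (toSite (ctrOff (3 + 1) Lc)) Lc (KInvStep (d := 3) Lc (j + 1)))))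
          (vertexOfK (unitK (sfStep Lc (j + 1)) (smStep 3 Lc (j + 1)) (coDressKBmAt (toSite (ctrOff (3 + 1) Lc)) Lc (KInvStep (d := 3) Lc (j + 1)))) Lc (unitS (sfStep Lc (j + 1)) (smStep 3 Lc (j + 1)) (fun κ t => ((Lc : ℝ) ^ 4 * wE 3 Lc (j + 1)) • e3OfK Lc (coDressKBmAt (toSite (ctrOff (3 + 1) Lc)) Lc (KInvStep (d := 3) Lc j))
              (fun κ u => comp (comp (trK (psiKS (ctrOff (3 + 1) Lc) Lc)) (slotPsiS (ctrOff (3 + 1) Lc) Lc (ScombOf (symTablesAn1S2 3 Lc cΛ) ((Lc : ℝ) ^ 4) (-((Lc : ℝ) ^ 8 / 2)) cΛ j) κ u)) (psiKS (ctrOff (3 + 1) Lc) Lc)) κ t)) κ' u') yw.1 yw.2 (Sum.inl κ₁) (Sum.inl κ₂)) +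
            (∑ c ∈ box (3 + 1) Lc, ∑' u' : Site (3 + 1), ∑' yw : Site (3 + 1) × Site (3 + 1), (if yw.1 κ₁ % (Lc : ℤ) = (Lc : ℤ) - 1 then (1 : ℝ) else 0) * (if yw.2 κ₂ % (Lc : ℤ) = (Lc : ℤ) - 1 then (1 : ℝ) else 0) *
        comp (comp (vertexOfK (unitK (sfStep Lc (j + 1)) (smStep 3 Lc (j + 1)) (coDressKBmAt (toSite (ctrOff (3 + 1) Lc)) Lc (KInvStep (d := 3) Lc (j + 1)))) Lc (unitS (sfStep Lc (j + 1)) (smStep 3 Lc (j + 1)) (fun κ t => ((Lc : ℝ) ^ 4 * wE 3 Lc (j + 1)) • e3OfK Lc (coDressKBmAt (toSite (ctrOff (3 + 1) Lc)) Lc (KInvStep (d := 3) Lc j))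
              (fun κ u => comp (comp (trK (psiKS (ctrOff (3 + 1) Lc) Lc)) (slotPsiS (ctrOff (3 + 1) Lc) Lc (ScombOf (symTablesAn1S2 3 Lc cΛ) ((Lc : ℝ) ^ 4) (-((Lc : ℝ) ^ 8 / 2)) cΛ j) κ u)) (psiKS (ctrOff (3 + 1) Lc) Lc)) κ t)) κ' u') (unitK (sfStep Lc (j + 1)) (smStep 3 Lc (j + 1)) (coDressKBmAt (toSite (ctrOff (3 + 1) Lc)) Lc (KInvStep (d := 3) Lc (j + 1)))))
          (vertexOfK (unitK (sfStep Lc (j + 1)) (smStep 3 Lc (j + 1)) (coDressKBmAt (toSite (ctrOff (3 + 1) Lc)) Lc (KInvStep (d := 3) Lc (j + 1)))) Lc (unitS (sfStep Lc (j + 1)) (smStep 3 Lc (j + 1)) (fun κ t => ((Lc : ℝ) ^ 4 * wE 3 Lc (j + 1)) • e3OfK Lc (coDressKBmAt (toSite (ctrOff (3 + 1) Lc)) Lc (KInvStep (d := 3) Lc j))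
              (fun κ u => comp (comp (trK (psiKS (ctrOff (3 + 1) Lc) Lc)) (slotPsiS (ctrOff (3 + 1) Lc) Lc (ScombOf (symTablesAn1S2 3 Lc cΛ) ((Lc : ℝ) ^ 4) (-((Lc : ℝ) ^ 8 / 2)) cΛ j) κ u)) (psiKS (ctrOff (3 + 1) Lc) Lc)) κ t)) κ (toSite c)) yw.1 yw.2 (Sum.inl κ₁) (Sum.inl κ₂)))
        = R κ κ₁ κ' κ₂ + R κ' κ₁ κ κ₂ := by
  have h := exists_pairForm_eeWords_smul (d := 3) (Lc := Lc) cΛ (sfStep Lc (j + 1)) (smStep 3 Lc (j + 1)) ((Lc : ℝ) ^ (3 + 1) * wE 3 Lc (j + 1)) cΛ j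
    (((Lc : ℝ) ^ 8 * (Lc : ℝ) ^ (2 * (3 + 1))) * (-((sfStep Lc (j + 1) * smStep 3 Lc (j + 1) * ((((Lc ^ (j + 1 + 1) : ℕ) : ℝ)) ^ (3 + 1 + 1))⁻¹) * (sfStep Lc (j + 1) * smStep 3 Lc (j + 1) * ((((Lc ^ (j + 1 + 1) : ℕ) : ℝ)) ^ (3 + 1 + 1))⁻¹)) * ((Lc : ℝ) * (Lc : ℝ))))
  have e1 : -((Lc : ℝ) ^ (3 + 1) * (1 / 2) * (Lc : ℝ) ^ (3 + 1)) = -((Lc : ℝ) ^ 8 / 2) := by ring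
  have e2 : ((Lc : ℝ) ^ (3 + 1)) = (Lc : ℝ) ^ 4 := by norm_num
  rw [e1, e2] at h
  exact h

end Summit.QuantumFields.BalabanUV.Beta.GAN24.CombExchangeESectorPairFormAn1

end
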